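import Mathlib
import Literature.AlgebraicGeometry.Resolution.NeronPopescuReduceToField
import Literature.AlgebraicGeometry.Resolution.NeronPopescuStepsProofs
import HarnessLib

/-!
# The fibrewise Popescu criterion over a Noetherian base
# (crux `IndSmooth.ValuativeSmoothing`, stmt-ResolutionOfSingularities-16087, line `birth`,
# lead c1 devissage programme "discrete jumps": stub `hasSmoothFactorizations_of_flat_of_fibre`)

We prove: if `R` is a Noetherian ring, `Λ` a FLAT `R`-algebra (arbitrary, typically
non-Noetherian) and every fibre `κ(𝔭) → κ(𝔭) ⊗_R Λ` has PT (every finite type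
`κ(𝔭)`-algebra map to the fibre factors through a smooth `κ(𝔭)`-algebra,
`HasSmoothFactorizations`), then `R → Λ` has PT (`hasSmoothFactorizations_of_flat_of_fibre`).
This is the "slicing criterion for ind-smooth ring maps" over a Noetherian base (L. Tang,
*Slicing criterion for ind-smooth ring maps*, arXiv:2404.17988, Theorem 1.2 / Corollary 1.3 in
the case of a Noetherian base), and its proof is the printed proof of Stacks, Lemma 07F5
("PT over fields implies PT in general") re-run word for word with the hypothesis "regular
homomorphism of Noetherian rings" replaced by "`R` Noetherian, `Λ` flat over `R`, all fibres
have PT": the only two uses of regularity in that proof are (i) that the class is stable under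
`R ↦ R/I`, `Λ ↦ Λ/IΛ` (here: flatness and the fibres are stable under this base change) and
(ii) that PT holds for `K_i → K_i ⊗_R Λ` for the factors `K_i = κ(𝔭_i)` of the total ring of
fractions `Q = K₁ × … × K_n` of the reduced Noetherian ring `R` (here: this IS the hypothesis at
the minimal primes `𝔭_i`). Everything else — Proposition 07CM for the nilradical (which needs
exactly `Λ` flat over `R`), 07CI, 07F4, PT for `R/π⁸R → Λ/π⁸Λ` by Noetherian induction, 07CP,
07CT — is the tree's assembly `Stacks07F5_reduceToField_of_smooth`
(`NeronPopescuReduceToField.lean`) with the proved inputs of `NeronPopescuStepsProofs.lean`.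

Contents:

* `hasSmoothFactorizations_tensor_of_algEquiv`, `hasSmoothFactorizations_tensor_cancelBaseChange`
  — transport of "PT for `K → K ⊗_R Λ`" along `K ≅ K'` and `K ⊗_{R'} (R' ⊗_R Λ) ≅ K ⊗_R Λ`;
* `hasSmoothFactorizations_fibre_of_surjectiveOnStalks` — for `R → R'` surjective on stalks
  (a quotient map, a localisation) the fibres of `R' → R' ⊗_R Λ` are fibres of `R → Λ`
  (`κ(𝔮) = κ(𝔮 ∩ R)`), hence have PT;
* `flat_quotient_map`, `hasSmoothFactorizations_fibre_quotient` — (i): the class is stable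
  under `R ↦ R/I`;
* `hasSmoothFactorizations_fractionRing_of_fibre` — (ii): PT for `S⁻¹R → S⁻¹Λ`, `R` reduced
  Noetherian, `S` the non-zero-divisors (`Q = S⁻¹R` is reduced Artinian, `Q = ∏ Q/𝔪`, and
  `Q/𝔪 → S⁻¹Λ/𝔪S⁻¹Λ` is the fibre at `𝔪 ∩ R`; 07F3 in the form
  `HasSmoothFactorizations.of_pairwise_isCoprime`);
* `hasSmoothFactorizations_step` — the body of the printed proof of 07F5 for the new class;
* `hasSmoothFactorizations_of_flat_of_fibre` — the Noetherian induction on the ideals of `R`.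

References: The Stacks Project, *Smoothing Ring Maps*, Lemma 07F5 and its proof
[StacksProject]; L. Tang, arXiv:2404.17988.
-/

-- single-problem summit: the doubled namespace component is forced
set_option linter.dupNamespace false

open scoped TensorProduct nonZeroDivisors

namespace Summit.ResolutionOfSingularities.ResolutionOfSingularities.Theorems.ValuativeSmoothing

open Literature.AlgebraicGeometry.Resolution

/-! ## Transport of PT for fibres `K → K ⊗_R Λ` -/

/-- PT for `K' → K' ⊗_S M` gives PT for `K → K ⊗_S M` when `K ≅ K'` as `S`-algebras (the pair
`(K, K ⊗_S M)` is isomorphic to `(K', K' ⊗_S M)`). [folklore] -/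
theorem hasSmoothFactorizations_tensor_of_algEquiv {S M K K' : Type} [CommRing S] [CommRing M]
    [Algebra S M] [CommRing K] [CommRing K'] [Algebra S K] [Algebra S K'] (e : K ≃ₐ[S] K')
    (h : HasSmoothFactorizations K' (K' ⊗[S] M)) : HasSmoothFactorizations K (K ⊗[S] M) := by
  let eM : K ⊗[S] M ≃ₐ[S] K' ⊗[S] M := Algebra.TensorProduct.congr e AlgEquiv.refl
  refine h.of_ringEquiv_pair e.symm.toRingEquiv eM.symm.toRingEquiv fun k => ?_
  change eM.symm (algebraMap K' (K' ⊗[S] M) k) = algebraMap K (K ⊗[S] M) (e.symm k)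
  simp [eM, Algebra.TensorProduct.algebraMap_apply]

/-- PT for `K → K ⊗_R Λ` gives PT for `K → K ⊗_{R'} (R' ⊗_R Λ)` for any intermediate
`R → R' → K` (`K ⊗_{R'} (R' ⊗_R Λ) ≅ K ⊗_R Λ` as `K`-algebras). [folklore] -/
theorem hasSmoothFactorizations_tensor_cancelBaseChange {R R' K Λ : Type} [CommRing R]
    [CommRing R'] [CommRing K] [CommRing Λ] [Algebra R R'] [Algebra R K] [Algebra R' K]
    [IsScalarTower R R' K] [Algebra R Λ] (h : HasSmoothFactorizations K (K ⊗[R] Λ)) :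
    HasSmoothFactorizations K (K ⊗[R'] (R' ⊗[R] Λ)) :=
  h.of_algEquiv (Algebra.TensorProduct.cancelBaseChange R R' K K Λ).symm

/-- **The fibres of a base change along a map which is surjective on stalks are fibres.** If
every fibre `κ(𝔭) → κ(𝔭) ⊗_R Λ` of `R → Λ` has PT and `R → R'` is surjective on stalks (e.g.
`R → R/I`, `R → S⁻¹R`), then for every prime `𝔮` of `R'` the fibre
`κ(𝔮) → κ(𝔮) ⊗_{R'} (R' ⊗_R Λ)` has PT: indeed `κ(𝔮 ∩ R) → κ(𝔮)` is an isomorphism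
(Mathlib's `RingHom.SurjectiveOnStalks.residueFieldMap_bijective`) and
`κ(𝔮) ⊗_{R'} (R' ⊗_R Λ) = κ(𝔮) ⊗_R Λ`. [folklore] -/
theorem hasSmoothFactorizations_fibre_of_surjectiveOnStalks {R Λ : Type} [CommRing R]
    [CommRing Λ] [Algebra R Λ]
    (hfib : ∀ (p : Ideal R) [p.IsPrime],
      HasSmoothFactorizations p.ResidueField (p.ResidueField ⊗[R] Λ))
    (R' : Type) [CommRing R'] [Algebra R R'] (H : (algebraMap R R').SurjectiveOnStalks)
    (q : Ideal R') [q.IsPrime] :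
    HasSmoothFactorizations q.ResidueField (q.ResidueField ⊗[R'] (R' ⊗[R] Λ)) := by
  have hpq : q.under R = q.comap (Algebra.ofId R R').toRingHom := rfl
  let e : (q.under R).ResidueField ≃ₐ[R] q.ResidueField :=
    AlgEquiv.ofBijective (Ideal.ResidueField.mapₐ (q.under R) q (Algebra.ofId R R') hpq)
      (H.residueFieldMap_bijective (q.under R) q hpq)
  have h1 : HasSmoothFactorizations q.ResidueField (q.ResidueField ⊗[R] Λ) :=
    hasSmoothFactorizations_tensor_of_algEquiv e.symm (hfib (q.under R))
  exact hasSmoothFactorizations_tensor_cancelBaseChange h1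

/-! ## Stability of the class under `R ↦ R/I`, `Λ ↦ Λ/IΛ` -/

/-- `Λ/IΛ = (R/I) ⊗_R Λ` is flat over `R/I` when `Λ` is flat over `R` (base change).
[folklore] -/
theorem flat_quotient_map {R Λ : Type} [CommRing R] [CommRing Λ] [Algebra R Λ] [Module.Flat R Λ]
    (I : Ideal R) : Module.Flat (R ⧸ I) (Λ ⧸ I.map (algebraMap R Λ)) :=
  Module.Flat.of_linearEquiv (Algebra.TensorProduct.quotIdealMapEquivQuotTensor Λ I).toLinearEquiv

/-- The fibres of `R/I → Λ/IΛ` are fibres of `R → Λ` (at the primes containing `I`), so they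
have PT if all fibres of `R → Λ` do. [folklore] -/
theorem hasSmoothFactorizations_fibre_quotient {R Λ : Type} [CommRing R] [CommRing Λ]
    [Algebra R Λ]
    (hfib : ∀ (p : Ideal R) [p.IsPrime],
      HasSmoothFactorizations p.ResidueField (p.ResidueField ⊗[R] Λ))
    (I : Ideal R) :
    ∀ (q : Ideal (R ⧸ I)) [q.IsPrime], HasSmoothFactorizations q.ResidueField
      (q.ResidueField ⊗[R ⧸ I] (Λ ⧸ I.map (algebraMap R Λ))) := by
  intro q _
  have H : (algebraMap R (R ⧸ I)).SurjectiveOnStalks :=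
    RingHom.surjectiveOnStalks_of_surjective Ideal.Quotient.mk_surjective
  have h := hasSmoothFactorizations_fibre_of_surjectiveOnStalks hfib (R ⧸ I) H q
  exact h.of_algEquiv (Algebra.TensorProduct.congr
    (AlgEquiv.refl : q.ResidueField ≃ₐ[q.ResidueField] q.ResidueField)
    (Algebra.TensorProduct.quotIdealMapEquivQuotTensor Λ I).symm)

/-! ## PT for `S⁻¹R → S⁻¹Λ`, `R` reduced (the step `Q = K₁ × … × K_n` of 07F5) -/

/-- **PT for `S⁻¹R → S⁻¹Λ` from PT of the fibres** (the step "`Q = K₁ × … × K_n` is a product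
of fields, see Algebra, Lemmas 02LX and 00EW. By Lemma 07F3 and our assumption PT holds for
the ring map `S⁻¹R → S⁻¹Λ`" of the proof of Stacks 07F5, with "our assumption" now being PT
for the fibres of `R → Λ`). Here `R` is reduced Noetherian, `S` its non-zero-divisors, `Q`,
`Λ'` any localisations of `R`, `Λ` at `S`: `Q` is reduced Artinian
(`isArtinianRing_of_isFractionRing_of_isReduced`), `Λ' = Q ⊗_R Λ`, and for a maximal ideal
`𝔪` of `Q` the map `Q/𝔪 → Λ'/𝔪Λ' = (Q/𝔪) ⊗_Q (Q ⊗_R Λ)` is the fibre of `R → Λ` at `𝔪 ∩ R`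
(`R → Q` is surjective on stalks); 07F3 is `HasSmoothFactorizations.of_pairwise_isCoprime`.
[cite: StacksProject, Tag 07F5 (proof)] -/
theorem hasSmoothFactorizations_fractionRing_of_fibre {R Λ : Type} [CommRing R] [CommRing Λ]
    [Algebra R Λ] [IsReduced R] [IsNoetherianRing R]
    (hfib : ∀ (p : Ideal R) [p.IsPrime],
      HasSmoothFactorizations p.ResidueField (p.ResidueField ⊗[R] Λ))
    (Q Λ' : Type) [CommRing Q] [Algebra R Q] [IsFractionRing R Q] [CommRing Λ']
    [Algebra Λ Λ'] [Algebra R Λ'] [IsScalarTower R Λ Λ']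
    [IsLocalization (Algebra.algebraMapSubmonoid Λ (nonZeroDivisors R)) Λ'] [Algebra Q Λ']
    [IsScalarTower R Q Λ'] : HasSmoothFactorizations Q Λ' := by
  haveI : IsNoetherianRing Q := IsLocalization.isNoetherianRing (nonZeroDivisors R) Q inferInstance
  haveI : IsReduced Q := isReduced_localizationPreserves (nonZeroDivisors R) Q inferInstance
  haveI : IsArtinianRing Q := isArtinianRing_of_isFractionRing_of_isReduced (R := R) Q
  -- `Λ' = Q ⊗_R Λ`
  haveI : Algebra.IsPushout R Q Λ Λ' :=
    (Algebra.isPushout_of_isLocalization (nonZeroDivisors R) Q Λ Λ').symm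
  refine HasSmoothFactorizations.of_algEquiv (Algebra.IsPushout.equiv R Q Λ Λ') ?_
  have HQ : (algebraMap R Q).SurjectiveOnStalks :=
    RingHom.surjectiveOnStalks_of_isLocalization (nonZeroDivisors R) Q
  -- 07F3 over the maximal ideals of the reduced Artinian ring `Q`
  refine HasSmoothFactorizations.of_pairwise_isCoprime (ι := MaximalSpectrum Q)
    (fun I => I.asIdeal) (fun I J hIJ => MaximalSpectrum.isCoprime_of_ne hIJ) ?_ fun I => ?_
  · change iInf MaximalSpectrum.asIdeal = ⊥
    rw [← IsArtinianRing.nilradical_eq_iInf, nilradical_eq_zero, Ideal.zero_eq_bot]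
  · haveI : I.asIdeal.IsMaximal := I.isMaximal
    -- the fibre of `Q → Q ⊗_R Λ` at `𝔪`, i.e. the fibre of `R → Λ` at `𝔪 ∩ R`, has PT
    have hF := hasSmoothFactorizations_fibre_of_surjectiveOnStalks hfib Q HQ I.asIdeal
    -- `Q/𝔪 = κ(𝔪)`
    let e : (Q ⧸ I.asIdeal) ≃ₐ[Q] I.asIdeal.ResidueField :=
      AlgEquiv.ofBijective (IsScalarTower.toAlgHom Q (Q ⧸ I.asIdeal) I.asIdeal.ResidueField)
        I.asIdeal.bijective_algebraMap_quotient_residueField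
    have h2 : HasSmoothFactorizations (Q ⧸ I.asIdeal) ((Q ⧸ I.asIdeal) ⊗[Q] (Q ⊗[R] Λ)) :=
      hasSmoothFactorizations_tensor_of_algEquiv e hF
    -- `(Q ⊗_R Λ)/𝔪(Q ⊗_R Λ) = (Q/𝔪) ⊗_Q (Q ⊗_R Λ)`
    exact h2.of_algEquiv
      (Algebra.TensorProduct.quotIdealMapEquivQuotTensor (Q ⊗[R] Λ) I.asIdeal).symm

/-! ## The body of the proof of 07F5 for the class "base Noetherian, flat, fibres with PT" -/

/-- **The induction step of Stacks 07F5, fibrewise version.** Let `R ≠ 0` be Noetherian, `Λ`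
flat over `R` with all fibres `κ(𝔭) → κ(𝔭) ⊗_R Λ` having PT, and assume PT for
`R/I → Λ/IΛ` for every ideal `I ≠ 0`. Then PT holds for `R → Λ`. The proof is the printed
proof of 07F5 from "In particular, we see by applying Proposition 07CM that `R` is a reduced
ring" to the end, exactly as assembled in `Stacks07F5_reduceToField_of_smooth`: 07CM for the
nilradical (`Stacks07CM_exists_smooth_factorization`, using `Λ` flat over `R`, fed by 07CI
`hasStandardSmoothFactorizations_of_hasSmoothFactorizations`), PT for `S⁻¹R → S⁻¹Λ`
(`hasSmoothFactorizations_fractionRing_of_fibre`), a standard smooth factorisation of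
`S⁻¹A → S⁻¹Λ` (07CI), 07F4 (`exists_elementaryStandard_factorization`), the annihilator
conditions for `π ∈ S` (`π` is `Λ`-regular as `Λ` is flat), PT for `R/π⁸R → Λ/π⁸Λ`, 07CP
(`Stacks07CP_of_smooth`) with `π⁴`, 07CT (`Stacks07CT_of_smooth`) with `π`, and
`H_{D/R} = D ⇒ H_{B/R} = B`. [cite: StacksProject, Tag 07F5 (proof)] -/
theorem hasSmoothFactorizations_step (R Λ : Type) [CommRing R] [CommRing Λ] [Algebra R Λ]
    [IsNoetherianRing R] [Nontrivial R] [Module.Flat R Λ]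
    (hfib : ∀ (p : Ideal R) [p.IsPrime],
      HasSmoothFactorizations p.ResidueField (p.ResidueField ⊗[R] Λ))
    (ih : ∀ I : Ideal R, I ≠ ⊥ → HasSmoothFactorizations (R ⧸ I) (Λ ⧸ I.map (algebraMap R Λ))) :
    HasSmoothFactorizations R Λ := by
  -- `R` is reduced, by 07CM applied to the nilradical
  by_cases hN : nilradical R = ⊥
  swap
  · -- 07CM, the standard smooth factorisations over `R/N` being supplied from PT for
    -- `R/N → Λ/NΛ` (induction hypothesis) by 07CI
    have h₀ : HasStandardSmoothFactorizations (R ⧸ nilradical R)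
        (Λ ⧸ (nilradical R).map (algebraMap R Λ)) :=
      hasStandardSmoothFactorizations_of_hasSmoothFactorizations (ih _ hN)
    intro A _ _ hA φ
    haveI : Algebra.FinitePresentation R A := (Algebra.FinitePresentation.of_finiteType).mp hA
    obtain ⟨C, _, _, hC, α, β, hαβ⟩ := Stacks07CM_exists_smooth_factorization (nilradical R)
      (IsNoetherianRing.isNilpotent_nilradical R) h₀ A φ
    exact ⟨C, inferInstance, inferInstance, hC, α, β, hαβ⟩
  haveI : IsReduced R := nilradical_eq_bot_iff.mp hN
  -- the factorisation problem
  intro A _ _ hA φ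
  haveI := hA
  haveI : Algebra.FinitePresentation R A := (Algebra.FinitePresentation.of_finiteType).mp hA
  -- PT for `S⁻¹R → S⁻¹Λ`, `S` the non-zero-divisors
  let Q : Type := Localization (R⁰)
  let AS : Type := Localization (Algebra.algebraMapSubmonoid A R⁰)
  let ΛS : Type := Localization (Algebra.algebraMapSubmonoid Λ R⁰)
  have hQ : HasSmoothFactorizations Q ΛS := hasSmoothFactorizations_fractionRing_of_fibre hfib Q ΛS
  -- the localised map `S⁻¹A → S⁻¹Λ` and a standard smooth factorisation of it (07CI)
  let φS : AS →ₐ[Q] ΛS := IsLocalization.mapₐ R⁰ Q AS ΛS φ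
  have hφS : ∀ a : A, φS (algebraMap A AS a) = algebraMap Λ ΛS (φ a) := fun a => by
    change (IsLocalization.mapₐ R⁰ Q AS ΛS φ : AS → ΛS) (algebraMap A AS a) = _
    rw [IsLocalization.mapₐ_coe, IsLocalization.map_eq]
    rfl
  have hAS : Algebra.FiniteType Q AS := by
    haveI : IsLocalization (R⁰.map (algebraMap R A)) AS :=
      (inferInstance : IsLocalization (Algebra.algebraMapSubmonoid A R⁰) AS)
    have hft := RingHom.finiteType_localizationPreserves (algebraMap R A) R⁰ Q AS
      (RingHom.finiteType_algebraMap.mpr inferInstance)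
    exact RingHom.finiteType_algebraMap.mp hft
  haveI : IsNoetherianRing Q := IsLocalization.isNoetherianRing R⁰ Q inferInstance
  haveI := hAS
  have hASfp : Algebra.FinitePresentation Q AS := (Algebra.FinitePresentation.of_finiteType).mp hAS
  obtain ⟨B', _, _, hB', v', w', hvw'⟩ :=
    hasStandardSmoothFactorizations_of_hasSmoothFactorizations hQ AS hASfp φS
  -- 07F4: `A → B → Λ` with `π ∈ S` elementary standard in `B`
  haveI : Algebra.IsStandardSmooth Q B' := hB'
  obtain ⟨B, _, _, v, w, hvw, π, hπS, hπel⟩ :=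
    exists_elementaryStandard_factorization R A Λ φ R⁰ Q AS ΛS φS hφS B' v' w' hvw'
  haveI : Algebra.FinitePresentation R B := hπel.finitePresentation
  have hπst : IsStrictlyStandard R (algebraMap R B π) := hπel.isStrictlyStandard
  suffices hw : FactorsThroughSmooth R w from FactorsThroughSmooth.of_comp v hw hvw
  -- annihilator conditions for `π` and `ϖ = π⁴`
  have hϖS : π ^ 4 ∈ R⁰ := pow_mem hπS 4
  have hAnnR : ∀ r : R, (π ^ 4) ^ 2 * r = 0 → π ^ 4 * r = 0 :=
    ann_eq_ann_sq_of_mem_nonZeroDivisors hϖS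
  have hAnnΛ : ∀ x : Λ, algebraMap R Λ (π ^ 4) ^ 2 * x = 0 → algebraMap R Λ (π ^ 4) * x = 0 :=
    ann_eq_ann_sq_algebraMap_of_flat hϖS
  have hAnnRπ : ∀ r : R, π ^ 2 * r = 0 → π * r = 0 := ann_eq_ann_sq_of_mem_nonZeroDivisors hπS
  have hAnnΛπ : ∀ x : Λ, algebraMap R Λ π ^ 2 * x = 0 → algebraMap R Λ π * x = 0 :=
    ann_eq_ann_sq_algebraMap_of_flat hπS
  -- PT for `R/π⁸R → Λ/π⁸Λ` applied to `B/π⁸B → Λ/π⁸Λ`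
  set I8 : Ideal R := Ideal.span {(π ^ 4) ^ 2} with hI8
  have hI8ne : I8 ≠ ⊥ := by
    rw [hI8, Ne, Ideal.span_singleton_eq_bot]
    exact nonZeroDivisors.ne_zero (pow_mem hϖS 2)
  have hPT8 : HasSmoothFactorizations (R ⧸ I8) (Λ ⧸ I8.map (algebraMap R Λ)) := ih I8 hI8ne
  have hle8 : I8.map (algebraMap R B) ≤ (I8.map (algebraMap R Λ)).comap w := by
    rw [Ideal.map_le_iff_le_comap]
    intro r hr
    rw [Ideal.mem_comap, Ideal.mem_comap, AlgHom.commutes]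
    exact Ideal.mem_map_of_mem _ hr
  let w8 : (B ⧸ I8.map (algebraMap R B)) →ₐ[R ⧸ I8] (Λ ⧸ I8.map (algebraMap R Λ)) :=
    AlgHom.extendScalarsOfSurjective (Ideal.Quotient.mk_surjective (I := I8))
      (Ideal.quotientMapₐ (I8.map (algebraMap R Λ)) w hle8)
  have hB8 : Algebra.FiniteType (R ⧸ I8) (B ⧸ I8.map (algebraMap R B)) :=
    Algebra.FiniteType.of_restrictScalars_finiteType R (R ⧸ I8) _
  obtain ⟨C, _, _, hC, v8, γ8, hvγ8⟩ := hPT8 (B ⧸ I8.map (algebraMap R B)) hB8 w8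
  -- `C` as an `R`-algebra
  letI : Algebra R C := ((algebraMap (R ⧸ I8) C).comp (Ideal.Quotient.mk I8)).toAlgebra
  haveI : IsScalarTower R (R ⧸ I8) C := IsScalarTower.of_algebraMap_eq fun _ => rfl
  -- 07CP with `ϖ = π⁴`
  obtain ⟨D, _, _, hD, δ, ε, hcomm⟩ :=
    Stacks07CP_of_smooth R Λ (π ^ 4) inferInstance hAnnR hAnnΛ C hC (γ8.restrictScalars R)
  haveI : Algebra.Smooth R D := hD
  -- the map `ρ : B/π⁴B → D/π⁴D` induced by `B → B/π⁸B → C → D/π⁴D`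
  let θ : B →ₐ[R] D ⧸ (Ideal.span {π ^ 4}).map (algebraMap R D) :=
    ε.comp (((v8.restrictScalars R)).comp (Ideal.Quotient.mkₐ R (I8.map (algebraMap R B))))
  have hθ : ∀ b ∈ (Ideal.span {π ^ 4}).map (algebraMap R B), θ b = 0 := by
    intro b hb
    rw [Ideal.map_span, Set.image_singleton] at hb
    obtain ⟨b', rfl⟩ := Ideal.mem_span_singleton'.mp hb
    rw [map_mul, AlgHom.commutes, IsScalarTower.algebraMap_apply R D (D ⧸ _),
      Ideal.Quotient.algebraMap_eq, Ideal.Quotient.eq_zero_iff_mem.mpr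
        (Ideal.mem_map_of_mem _ (Ideal.mem_span_singleton_self _)), mul_zero]
  let ρ : (B ⧸ (Ideal.span {π ^ 4}).map (algebraMap R B)) →ₐ[R]
      (D ⧸ (Ideal.span {π ^ 4}).map (algebraMap R D)) :=
    Ideal.Quotient.liftₐ _ θ hθ
  have hρ : ∀ (b : B) (d : D), Ideal.Quotient.mk _ d = ρ (Ideal.Quotient.mk _ b) →
      Ideal.Quotient.mk ((Ideal.span {π ^ 4}).map (algebraMap R Λ)) (δ d) =
        Ideal.Quotient.mk ((Ideal.span {π ^ 4}).map (algebraMap R Λ)) (w b) := by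
    intro b d hd
    refine hcomm (v8 (Ideal.Quotient.mk _ b)) d (w b) hd ?_
    change _ = γ8 (v8 (Ideal.Quotient.mk _ b))
    rw [← AlgHom.comp_apply, hvγ8]
    rfl
  -- 07CT with `π`
  obtain ⟨B₂, _, _, hB₂fp, β, i, j, hβi, -, hH⟩ :=
    Stacks07CT_of_smooth R Λ π inferInstance hAnnRπ hAnnΛπ B D inferInstance inferInstance
      inferInstance w δ hπst ρ hρ
  haveI := hB₂fp
  -- `H_{D/R} = D`, hence `H_{B₂/R} = B₂`, i.e. `B₂` is smooth over `R`
  have htop : singularIdeal R B₂ = ⊤ := by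
    refine top_le_iff.mp ?_
    calc (⊤ : Ideal B₂) = (singularIdeal R D).map j := by
          rw [singularIdeal_eq_top_of_smooth, Ideal.map_top]
      _ ≤ singularIdeal R B₂ := hH
  have hB₂ : Algebra.Smooth R B₂ := singularIdeal_eq_top_iff.mp htop
  exact ⟨B₂, inferInstance, inferInstance, hB₂, i, β, hβi⟩

/-! ## The Noetherian induction on the ideals of `R` -/

/-- **The fibrewise Popescu criterion over a Noetherian base** (stub A of the devissage; Tang's
slicing criterion for ind-smooth ring maps in the case of a Noetherian base). Let `R` be a
Noetherian ring and `Λ` a flat `R`-algebra such that for every prime `𝔭` of `R` the fibre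
`κ(𝔭) → κ(𝔭) ⊗_R Λ` has PT (every finite type `κ(𝔭)`-algebra over the fibre factors through a
smooth `κ(𝔭)`-algebra). Then `R → Λ` has PT: every finite type `R`-algebra `A → Λ` factors
through a smooth `R`-algebra. Proof: the printed proof of Stacks, Lemma 07F5 with "regular" replaced
by "flat with ind-smooth fibres" — Noetherian induction on the ideals `I` of `R` applied to
`R/I → Λ/IΛ` (which stays in the class: `flat_quotient_map`,
`hasSmoothFactorizations_fibre_quotient`; bookkeeping `HasSmoothFactorizations.quotQuot`,
`.of_quotient_bot`, `hasSmoothFactorizations_of_subsingleton`), the step being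
`hasSmoothFactorizations_step`. [cite: StacksProject, Tag 07F5 (proof)]
[cite: Tang2024, Theorem 1.2] -/
theorem hasSmoothFactorizations_of_flat_of_fibre (R Λ : Type) [CommRing R] [CommRing Λ]
    [Algebra R Λ] [IsNoetherianRing R] [Module.Flat R Λ]
    (hfib : ∀ (p : Ideal R) [p.IsPrime],
      Literature.AlgebraicGeometry.Resolution.HasSmoothFactorizations p.ResidueField (TensorProduct
        R p.ResidueField Λ)) :
    Literature.AlgebraicGeometry.Resolution.HasSmoothFactorizations R Λ := by
  suffices key : ∀ I : Ideal R,
      HasSmoothFactorizations (R ⧸ I) (Λ ⧸ I.map (algebraMap R Λ)) from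
    (key ⊥).of_quotient_bot
  intro I
  induction I using IsNoetherian.induction with
  | hgt I ih =>
    rcases subsingleton_or_nontrivial (R ⧸ I) with hI | hI
    · exact hasSmoothFactorizations_of_subsingleton _ _
    · haveI : Module.Flat (R ⧸ I) (Λ ⧸ Ideal.map (algebraMap R Λ) I) := flat_quotient_map I
      refine hasSmoothFactorizations_step (R ⧸ I) (Λ ⧸ Ideal.map (algebraMap R Λ) I)
        (hasSmoothFactorizations_fibre_quotient hfib I) fun J' hJ' => ?_
      have hle : I ≤ J'.comap (Ideal.Quotient.mk I) := fun x hx => by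
        rw [Ideal.mem_comap, Ideal.Quotient.eq_zero_iff_mem.mpr hx]
        exact J'.zero_mem
      have hlt : I < J'.comap (Ideal.Quotient.mk I) := by
        refine lt_of_le_of_ne hle fun heq => hJ' ?_
        rw [← Ideal.map_comap_of_surjective (Ideal.Quotient.mk I) Ideal.Quotient.mk_surjective J',
          ← heq, Ideal.map_quotient_self]
      exact (ih _ hlt).quotQuot I J'

end Summit.ResolutionOfSingularities.ResolutionOfSingularities.Theorems.ValuativeSmoothing
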